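import Literature.NumberTheory.Automorphic.Liu2021.Sec42AlbaneseUnitaryShimuraII
import Literature.NumberTheory.Automorphic.Liu2021.Sec43FourierJacobiCycles
import Literature.NumberTheory.Automorphic.Liu2021.AppendixC.DefC1toC3
import Mathlib.Topology.LocallyConstant.Basic
import Mathlib.Topology.Algebra.Support
import Mathlib.Analysis.SpecialFunctions.Trigonometric.Basic
import Mathlib.RingTheory.Trace.Basic
import Mathlib.RingTheory.TensorProduct.Basic
import Mathlib.Algebra.Category.ModuleCat.Basic
import HarnessLib

/-!
# Liu 2021, §5.1 «A doubling formula for CM data» (print pp. 68–76, items 5.1–5.11) — SECTION CARPET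
# (statement-exact typing over ONE in-file hypothesis structure `Sec51Data`; no proofs)

[Liu2021] = Yifeng Liu, *Fourier–Jacobi cycles and arithmetic relative trace formula* (with an appendix by Chao Li and
Yihang Zhu), Cambridge J. Math. **9** (2021), no. 1, 1–147 (= arXiv:2102.11518).  SOURCES READ FOR THIS FILE: the held
PRINT text `paper:liu2021-fourier-jacobi-cycles-arithmetic-relative-trace-formula` (page file `pNNNN` = journal page `N`;
pp. 68–77 materialised) — every «(p. N)» below is the journal page of the item's first line — and, as second locator, the
author's TeX source `FJcycle.tex` (md5 `6db49a74122d2cb0…`, «l. N»; labels `le:doubling0` = Lem. 5.1, `le:doubling1` =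
Lem. 5.2, `de:generating_series` = Def. 5.3, `le:doubling2` = Lem. 5.5, `le:doubling3` = Lem. 5.6, `de:doubling` = Def. 5.8,
`le:doubling4` = Lem. 5.9, `pr:doubling` = Prop. 5.10, `re:bilinear` = Rem. 5.11).  Dedup (2026-09-02): no tree declaration
cites any item 5.1–5.11 of [Liu2021] (green field); squad TL «GO 500», TL-plan T2 deal «t12 = §5.1».

## Standing set-up of §5 (p. 68, l. 2859–2861), VERBATIM

«We keep the notation from Section 4. We fix a conjugate symplectic automorphic character `μ : E^× \ 𝔸_E^× → ℂ^×` of weight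
one, and a `μ`-admissible collection `ε` (Definition 4.12).  From now on, we will restrict ourselves to the Compact Case. We
will identify `E` as a subfield of `ℂ` via a fixed complex embedding `τ' ∈ Φ_μ`. Put `τ := τ'|_F`, and fix a hermitian space `V`
that is `τ`-nearby to `𝕍` (Definition C.4). In particular, `V` is anisotropic. Put `G := Res_{F/ℚ} U(V)`, and identify `X_K`
with the (proper) Shimura variety `Sh(G, h_{V,τ'})_K` under the notation in Remark C.2.»  §5.1 then fixes (p. 69, l. 2869–2872)
«a level subgroup `K ⊆ G(𝔸^∞)` and a CM data `D_μ = (A_μ, i_μ, λ_μ, r_μ) ∈ 𝒜(μ)`, as in Conjecture 4.37», i.e. with test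
functions `f₁, f₁^∨, f₂, f₂^∨ ∈ ℋ_{K,𝕃}`, a Hecke system of projectors `z` (Def. 4.35) and `φ ∈ Hom_E(A_K, A_μ, ε)`,
`φ_c ∈ Hom_E(A_K, A_μ^∨, −ε)` (Conj. 4.33 p. 65, Def. 4.35 ∕ Conj. 4.37 p. 67).

## Discipline (squad RULING «in-file hypothesis structures»; same conventions as `Thm418AsPrinted`, `Sec42AlbaneseUnitaryShimuraII`,
## `Sec3CyclesHeightPairings` — read «What a CARRIER is» there)

`Sec51Data D` is ONE hypothesis structure over the LANDED datum `D : Sec42IIData F E` of §4.2 (number fields `F ⊆ E` with the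
printed hypotheses as instance arguments; REAL `μ`, `M_μ = fieldOfValues E μ`; ⟨CARRIER⟩ `G = 𝔾(𝔸_F^∞)`, `Eps`, `Obj = 𝒜(μ)`,
`Ω(μ)`, `Ω(μ^c)`, `Hom_E(A_K, A_μ)_ℚ`, `Hom_E(A_K, A_μ^∨)_ℚ`, `CH¹(X_K)_ℚ`, `D_K`, `vol(K)`, `deg D_K^{n−1}`).  REAL new fields:
the admissible `ε`, the embedding `τ' ∈ Φ_μ`, the hermitian space `V` (tree `AppendixC.HermSpace F E`: `E`-vector space with
its form, `U(V)(F)`, `U(V)(𝔸_F^∞)`), the coefficient field `𝕃 ⊇ M_μ` (`Subfield ℂ`), the intermediate number field `E ⊆ E' ⊆ ℂ`, the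
Hecke functions `f₁, f₁^∨, f₂, f₂^∨ : 𝔾(𝔸_F^∞) → 𝕃` (REAL predicate `MemHecke` and `L_g = leftTranslate` of the landed §4.3 carpet
`Sec43FourierJacobiCycles` — ONE Hecke vocabulary for §4.3∕§5, squad QA-2),
Schwartz functions on `V(𝔸_E^∞) = (𝔸_E^∞)^n` (REAL: locally constant, compactly supported functions on Mathlib's finite
adèles, with the REAL action of `G(𝔸^∞)` through matrices), `V(E)^+` (REAL: totally positive vectors).  Every other object a
printed sentence NAMES — Chow groups and cycles of `X'_K × X'_K × X'_K`, `X'_K × X'_K × A'_μ`, `A_μ × A_μ^∨`, the Poincaré class,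
pull-backs and push-forwards along the printed correspondences and morphisms, the Beilinson–Bloch(–Poincaré) pairings, Betti
cohomology and cycle classes, special divisors, the index set of Kudla's double sum, the Kudla–Millson map `𝔡` — is a ⟨CARRIER⟩
field whose docstring quotes the printed definition; ⟨CARRIER LAW⟩ marks a printed property of a carrier used by a later sentence.
Objects the text DEFINES from those by a formula are REAL `def`s (`Δ^{φ,P}_z X_K`, `𝒬_μ`, `𝒬^{φ,φ_c,P,Q}_{μ,K}`, `V(E)^+`, the
generating series `Z(𝛗)_K` term by term, `S(V(𝔸_E^∞))^K`, `Hom_E(A_K, A_μ, ε)`, `𝐟_i = f_iᵗ ∗ f_i^∨`, `K_s = K ∩ g_s K g_s⁻¹`,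
doubling divisors); every numbered CLAIM is a predicate `def … (S : Sec51Data D) : Prop`.  NOTHING IS ASSERTED and nothing is
proved: a consumer takes `(h : S.Prop510)` for ITS OWN datum; `∀ S, …` is never Liu's statement.  Cross-section notions (§3:
Def. 3.3 Chow convergence, Lem. 3.5, Def. 3.7 BBP pairing — carpet `Sec3CyclesHeightPairings` (TL-t02); §4.3: `ℋ_{K,𝕃}`, `T^f_K`,
`Δ³X_K`, test functions Def. 4.26, `FJ(f₁,f₂;φ)_K`, Lem. 4.30 — carpet `Sec43…` (TL-t01); §4.4: Hecke systems of projectors Def. 4.35,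
`Δ³_z X_K`, `FJ(f₁,f₂;φ)^z_K`, Conj. 4.37, Rem. 4.38 — carpet `Sec44ArithmeticGGP` (TL-t02); §5.2 Def. 5.12 `I^z_K(f, 𝛗)` — carpet
`Sec52Sec53…` (TL-t13); §2 Def. 2.1 «splits», Def. 2.3 `α_P` — carpet `Sec2AlbaneseVariety` (TL-t08)) are posited here as ⟨CARRIER⟩
fields citing the item, NOT restated as structures (squad RULING 2026-09-02).

TYPER LINT: statements only — no `sorry`, no `axiom`, no theorem, no `instance` declaration and no instance attribute (module-
valued carriers are BUNDLED as Mathlib `ModuleCat R` objects), no `notation`/`macro`, no attribute removed.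

## READINGS (fixed here, quoted at the use site)

* R1 «`ℂ[G(𝔸^∞)]`-module isomorphism» (Lem. 5.5) = `ℂ`-linear, `G(𝔸^∞)`-equivariant, bijective onto the printed target;
  equivariance is stated on pure tensors `c ⊗ (φ ⊗ φ_c)` (equivalent by linearity).
* R2 `Ω(μ,ε) ⊗_{M_μ} Ω(μ^c,−ε) ⊗_{M_μ} ℂ` = Mathlib `ℂ ⊗[M_μ] (Ω(μ,ε) ⊗[M_μ] Ω(μ^c,−ε))` (order of factors is cosmetic).
* R3 `[E' : E]` = `finrank_ℚ E' / finrank_ℚ E` (as a rational number; `E ↪ E'` via `τ'`, both number fields).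
* R4 `Tr_{F/ℚ} (x,x)_V` = `Tr_{E/ℚ} (x,x)_V / 2` (`(x,x)_V ∈ F` by hermitian symmetry and `Tr_{E/F} a = 2a` on `F`), so
  `e^{−2π·Tr_{F/ℚ}(x,x)_V} = exp(−π · Tr_{E/ℚ}(x,x)_V)`; the same device as `HermSpace.IsPosAt`.
* R5 `V(𝔸_E^∞)` = `Fin n → 𝔸_E^∞` in the coordinates of `HermSpace.basis` (READING R4 of `DefC1toC3`: every printed notion is
  basis-invariant); `g ∈ G(𝔸^∞)` acts on it by the matrix of `g` under the fixed identification `gIso : U(V)(𝔸_F^∞) ≃ 𝔾(𝔸_F^∞)` of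
  l. 4624 (a ⟨CARRIER⟩, as in `Thm418Data.G`'s docstring); «action by `G(𝔸^∞)` via the variable» = `(g𝛗)(v) := 𝛗(g⁻¹ v)`.
* R6 «a ℂ-linear map `S(V(𝔸_E^∞))^K → H²_B`» (Lem. 5.6 (2)) is carried as a `ℂ`-linear map on ALL functions `V(𝔸_E^∞) → ℂ` whose
  values off `S(V(𝔸_E^∞))^K` are never used; «unique» = any two such maps agree on `S(V(𝔸_E^∞))^K`.
* R7 Prop. 5.10 prints «`Z^s_{K_s} ∈ Z¹(X_K × X_K)_ℂ` is an arbitrary doubling divisor for `𝔡(φ ⊗ g_s φ_c)`»; a doubling divisor OF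
  LEVEL `K_s` (Def. 5.8, used through Lem. 5.9 «which exists by Lemma 5.9») is an element of `Z¹(X_{K_s} × X_{K_s})_ℂ`, the group the
  pairing on `X⁶_{K_s}` consumes — typed in `Z¹(X_{K_s} × X_{K_s})_ℂ` [sic].
* R8 Sums «`Σ_i c_i P_i`», «`Σ_s d_s 𝟙_{g_s⁻¹K ∩ Kg_s⁻¹}`» printed as finite sums = a `List` ∕ a `Fin m`-indexed family.
* R9 The printed bold `𝛗 ∈ S(V(𝔸_E^∞))` is written `ϕ` in Lean code (the bold letter is not a Lean identifier character).

## INDEX (item ↦ declaration; namespace `Literature.NumberTheory.Automorphic.Liu2021.Sec51DoublingFormulaCMData`)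

| item (print) | page | TeX l. | declaration(s) |
|---|---|---|---|
| §5 standing set-up | 68 | 2859–2861 | fields `ε … gIso` of `Sec51Data` |
| (5.1) the BBP quantity | 69 | 2869–2872 | ⟨CARRIER⟩ `Sec51Data.bbpFJ` |
| `E'`, `X'_K`, `α_P`, `Δ^{φ,P}_z X_K`, `Δ^{φ_c,P}_z X_K` | 69 | 2874–2884 | fields `E' … pushPhic`; REAL `deltaPhi`, `deltaPhic` |
| **Lem. 5.1** | 69 | 2887–2895 | `Lem51` |
| `𝒫_μ`, `𝒬_μ`, `𝒬^{φ,φ_c,P,Q}_{μ,K}` | 69–70 | 2901–2908 | `poincare`, REAL `Qμ`, `QμK` |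
| **Lem. 5.2** (+ `Δ³_{z,𝐟₁,𝐟₂} X_K`) | 70 | 2912–2922 | `Lem52` (carrier `bb4`) |
| **Def. 5.3** `V(E)^+`, `Z(x,g)_K`, `S(V(𝔸_E^∞))`, `Z(𝛗)_K` | 71–72 | 2987–3005 | REAL `Vplus`, `IsSchwartz`, `gFun`, `IsSchwartzK`, `coordA`, `genSeries`; carriers `specialDivisor`, `Idx` |
| **Lem. 5.4** | 72 | 3009–3011 | `Lem54` |
| `φ ◇ φ_c`, the map `𝔡` (5.4) | 72 | 3015–3027 | ⟨CARRIER⟩ `dmap` |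
| **Lem. 5.5** | 72 | 3030–3032 | `Lem55` |
| **Lem. 5.6** (1), (2)(a)(b) | 73 | 3040–3057 | `Lem56_1`, `PropA`, `PropB` (level-generic), `Lem56_2` (carrier `cQ`) |
| **Rem. 5.7** | 73 | 3067–3070 | `Rem57` |
| **Def. 5.8** doubling divisor | 74 | 3073–3075 | REAL `IsDoublingDivisor` |
| **Lem. 5.9** | 74 | 3077–3079 | `Lem59` |
| **Prop. 5.10** (doubling formula) + `𝐟_i`, `K_s` | 74 | 3093–3100 | REAL `fT`, `bf₁`, `bf₂`, `levelCap`, `indKK` (+ ★ `leftTranslate`); `Prop510` |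
| **Rem. 5.11** | 76 | 3139–3150 | `Rem511` |

NOT typed (recorded here, no carrier posited): the commutative diagram and the chain (5.2)–(5.3) inside the PROOF of Lem. 5.2;
the `(1,1)`-form `φ ◇ φ_c := φ^*α ∧ φ_c^* \bar{α_c}`, its independence of `(α, α_c)`, «is moreover in `H²_B(X_K, M_μ(1))`» and
its identification with the Kudla–Millson theta form `θ_{ψ_F,μ,\tilde𝛗}(−,1)` ([BMM16, Prop. 5.19], [Liu14, Lem. 5.3]) — the
construction BEHIND `𝔡`, quoted on the carrier; the direct limit `H²_B(X_∞ × X_∞, ℂ) := lim_K H²_B(X_K × X_K, ℂ)` of Rem. 5.7 (its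
map `c𝒬_μ` is the formal consequence of the compatibility typed as `Rem57`); (5.5)–(5.7) (proof of Prop. 5.10); all proofs.

## References

* [Liu2021] §5.1 pp. 68–76; Def. 2.1, 2.3 (p. 22–23); Def. 3.3 (p. 35), Lem. 3.5 (p. 37), Def. 3.7 (p. 38); §4.3 pp. 57–63
  (Def. 4.26, Lem. 4.30); §4.4 pp. 63–68 (Def. 4.35, Conj. 4.37, Rem. 4.38); Def. 4.12, 4.19, 4.22 (§4.2); Def. C.4, Rem. C.2.
* [Kud97] S. Kudla, *Algebraic cycles on Shimura varieties of orthogonal type*; [Liu11a] Y. Liu, *Arithmetic theta lifting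
  and L-derivatives for unitary groups I* (Thm. 3.5 (2)); [BMM16] Bergeron–Millson–Moeglin (Prop. 5.19, (8.8), (8.9), Prop. 8.3);
  [Liu14] (Lem. 5.3); [Beĭ87] Beilinson, 4.0.3 — the sources §5.1 names (not used here).
-/

noncomputable section

open NumberField
open scoped TensorProduct Pointwise
open IsDedekindDomain (FiniteAdeleRing)
open Literature.NumberTheory.Automorphic.Liu2021 (fieldOfValues IsOpenCompact Thm418Data)
open Literature.NumberTheory.Automorphic.Liu2021.Sec42AlbaneseUnitaryShimuraII (Sec42IIData IsOmegaEps)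
open Literature.NumberTheory.Automorphic.Liu2021.AppendixC (HermSpace)

namespace Literature.NumberTheory.Automorphic.Liu2021.Sec51DoublingFormulaCMData

variable {F E : Type} [Field F] [NumberField F] [IsTotallyReal F] [Field E] [NumberField E] [Algebra F E]
  [IsTotallyComplex E] [Algebra.IsQuadraticExtension F E]

/-! ## Hecke functions: the squad's REAL tokens are `Sec43FourierJacobiCycles.MemHecke K f` («`f ∈ ℋ_{K,R}`»: bi-`K`-invariant,
finite double-coset support; `f : 𝔾(𝔸_F^∞) → R`), `leftTranslate g f` (`L_g`), `rightTranslate`, `indicatorFun` (§4.3 p. 57,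
landed carpet of TL-t01) — imported, not restated.  Only the transpose is new here. -/

/-- **The transpose `fᵗ`** (§4.4 p. 66, l. 2752: «`f_iᵗ` is the transpose of `f_i`, that is, `f_iᵗ(g) = f_i(g⁻¹)`»), for a function on
a group with values anywhere. REAL. [cite: Liu2021, §4.4 (p. 66)] -/
def fT {G R : Type} [Group G] (f : G → R) : G → R := fun g => f g⁻¹

/-! ## The datum of §5.1 -/

/-- **Data and standing hypotheses of [Liu2021, §5.1]** (p. 68–76), in paper order, over the landed §4.2 datum
`D : Sec42IIData F E`.  Fields marked ⟨CARRIER⟩ stand for printed objects Lean cannot construct (their printed definition is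
quoted); the other fields are genuine objects ∕ genuine printed hypotheses.  Nothing is asserted by this structure.
[cite: Liu2021, §5 (p. 68) and §5.1 (pp. 69–76)] -/
structure Sec51Data (D : Sec42IIData F E) : Type 1 where
  /-- «a `μ`-admissible collection `ε` (Definition 4.12)» (p. 68): the collection, in the carrier `Eps` of Def. 4.11. -/
  ε : D.Eps
  /-- «`μ`-admissible» (p. 68; Def. 4.12), the landed predicate `Thm418Data.IsAdmissible`. REAL hypothesis. -/
  ε_admissible : D.toThm418Data.IsAdmissible ε
  /-- «From now on, we will restrict ourselves to the Compact Case» (p. 68): the REAL `Sec42IIData.isCompactCase` (= not the Noncompact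
  Case of §4.2 p. 45). REAL hypothesis. -/
  compactCase : D.isCompactCase
  /-- «a fixed complex embedding `τ' ∈ Φ_μ`» (p. 68) through which «we will identify `E` as a subfield of `ℂ`». REAL. -/
  τ' : E →+* ℂ
  /-- «`τ' ∈ Φ_μ`» (p. 68), `Φ_μ` = `Thm418Data.cmType`, the CM type of `μ` (Def. 4.3 (2)). REAL hypothesis. -/
  τ'_mem : τ' ∈ D.toThm418Data.cmType.1
  /-- «fix a hermitian space `V` that is `τ`-nearby to `𝕍` (Definition C.4), `τ := τ'|_F`. In particular, `V` is anisotropic»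
  (p. 68) — REAL as the tree's `AppendixC.HermSpace F E` (the `E`-vector space `V.V` of rank `V.n` with its hermitian form
  `V.form`, `U(V)(F) = V.rationalPoints`, `U(V)(𝔸_F^∞) = V.Gfin`).  That `V` IS `τ`-nearby to the carrier `𝕍` of `Thm418Data`
  (Def. C.4: «`V ⊗_F 𝔸_F^τ ≃ 𝕍 ⊗_{𝔸_F} 𝔸_F^τ`, and `V ⊗_{F,τ} ℝ` has signature `(n−1, 1)`»; typed `AppendixC.IsNearby` on Gram
  matrices) is part of the MEANING of this field and of `gIso` (the carrier `𝕍` is a bare type). -/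
  V : HermSpace F E
  /-- `V` has the rank `n` of `𝕍` (p. 68 with §4.2 p. 45). REAL hypothesis. -/
  rank_eq : V.n = D.n
  /-- ⟨CARRIER⟩ the FIXED identification `G(𝔸^∞) = U(V)(𝔸_F^∞) ≃ 𝔾(𝔸_F^∞)` (App. C l. 4624; p. 68 «Put `G := Res_{F/ℚ} U(V)`, and
  identify `X_K` with the (proper) Shimura variety `Sh(G, h_{V,τ'})_K`»), through which `K ⊆ 𝔾(𝔸_F^∞)` indexes `Sh(G, h_{V,τ'})_K`
  and `g ∈ 𝔾(𝔸_F^∞)` acts on `V(𝔸_E^∞)` (READING R5). -/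
  gIso : V.Gfin ≃* D.G
  /-- ⟨CARRIER⟩ «level subgroup» (§4.3 p. 57, l. 2401: «sufficiently small open compact subgroups `K ⊆ 𝔾(𝔸_F^∞)` that are
  decomposable, that is, `K = Π_v K_v` … we call such `K` a *level subgroup*»; decomposability is not expressible on the bare
  carrier `G`). -/
  IsLevel : Subgroup D.G → Prop
  /-- «a level subgroup `K ⊆ G(𝔸^∞)`» of (5.1) (p. 69). -/
  K : Subgroup D.G
  /-- `K` is a level subgroup (p. 69). Hypothesis on the carrier predicate. -/
  K_level : IsLevel K
  /-- «`𝕃 ⊆ ℂ` a subfield containing `M_μ` over which `Π₁^∞` and `Π₂^∞` … are both defined» (§4.3 p. 59, l. 2470; Conj. 4.33 p. 65).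
  REAL subfield of `ℂ` (a Mathlib `Subfield ℂ`, the type used by the §4.3 carpet `Sec43FourierJacobiCycles` for `ℋ_{K,𝕃}`); the
  definability clause is part of the token `IsTestQuadruple`. -/
  L : Subfield ℂ
  /-- «containing `M_μ`» (l. 2470). REAL hypothesis. -/
  Mμ_le_L : (fieldOfValues E D.μ).toSubfield ≤ L
  /-- «a CM data `D_μ = (A_μ, i_μ, λ_μ, r_μ) ∈ 𝒜(μ)`» of (5.1) (p. 69), in the carrier `Obj` of `Thm418Data`. -/
  Dμ : D.Obj
  /-- ⟨CARRIER⟩ «the convolution product in `ℋ_{K,𝕃}`» (l. 2754), `ℋ_R` having «multiplication … given by the convolution with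
  respect to the canonical volume (Definition 4.22 (3))» (l. 2406) — indexed by the level `K`; values off `ℋ_{K,𝕃}` unused. -/
  conv : Subgroup D.G → (D.G → L) → (D.G → L) → (D.G → L)
  /-- ⟨CARRIER⟩ «test functions `f₁, f₁^∨, f₂, f₂^∨ ∈ ℋ_{K,𝕃}` for `π₁^∞, (π₁^∞)^∨, π₂^∞, (π₂^∞)^∨`, respectively» (Conj. 4.33,
  p. 65, l. 2734; Conj. 4.37, p. 67: «Let the setup be as in Conjecture 4.33»), for the relevant representations `Π₁, Π₂` of
  `GL_n(𝔸_E)` and pairs `(𝕍, π_i^∞) ∈ Φ_{Π_i}` (§4.3 p. 58) — Def. 4.26 (test function, p. 58): «`cl_{B,τ'}(T^f_K)` belongs to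
  `H^{n−1}_{B,τ'}(\widetilde{Sh}(𝕍)_K, ℂ)[(π^∞)^K] ⊗ H^{n−1}_{B,τ'}(…)[((π^∞)^∨)^K]` … for every `τ'`», typed in the §4.3 carpet as
  `Sec43FourierJacobiCycles.ShimuraData.IsTestFunction K π πd f` (a consumer holding a `ShimuraData D 𝕃` and the four
  representations instantiates this token with it, together with `ShimuraData.NotationAsAbove`); the representations are part of the
  MEANING of this token. -/
  IsTestQuadruple : (D.G → L) → (D.G → L) → (D.G → L) → (D.G → L) → Prop
  /-- `f₁ ∈ ℋ_{K,𝕃}` (Conj. 4.33, p. 65). REAL `𝕃`-valued function on `𝔾(𝔸_F^∞)` (the type of the §4.3 carpet). -/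
  f₁ : D.G → L
  /-- `f₁^∨ ∈ ℋ_{K,𝕃}` (p. 65). REAL. -/
  f₁v : D.G → L
  /-- `f₂ ∈ ℋ_{K,𝕃}` (p. 65). REAL. -/
  f₂ : D.G → L
  /-- `f₂^∨ ∈ ℋ_{K,𝕃}` (p. 65). REAL. -/
  f₂v : D.G → L
  /-- «`∈ ℋ_{K,𝕃}`» for the four functions (p. 65). REAL hypothesis, the §4.3 carpet's `MemHecke` (bi-`K`-invariant, finite
  double-coset support). -/
  hecke_mem : Sec43FourierJacobiCycles.MemHecke K f₁ ∧ Sec43FourierJacobiCycles.MemHecke K f₁v ∧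
    Sec43FourierJacobiCycles.MemHecke K f₂ ∧ Sec43FourierJacobiCycles.MemHecke K f₂v
  /-- «test functions … for `π₁^∞, (π₁^∞)^∨, π₂^∞, (π₂^∞)^∨`, respectively» (p. 65). Hypothesis on the carrier predicate. -/
  test : IsTestQuadruple f₁ f₁v f₂ f₂v
  /-- ⟨CARRIER⟩ the set of Hecke systems of projectors `z = (z_K ∈ CH^{n−1}(X_K × X_K)_ℚ)_K` (Def. 4.35, p. 67: each `z_K` an odd
  projector, compatible with transition morphisms and Hecke translations; typed in the §4.4 carpet `Sec44ArithmeticGGP`, TL-t02). -/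
  Zsys : Type
  /-- «Take a Hecke system of projectors `z = (z_K)_K`» (Conj. 4.37, p. 67): the fixed one, entering `Δ³_z X_K := pr^{[3]}_{z_K} Δ³ X_K`
  and `FJ(f₁, f₂; φ)^z_K` (p. 67) — part of the MEANING of `delta3z`, `bbpFJ`, `bb4`, `bb6` below. -/
  z : Zsys
  /-- `Ω(μ, ε) ≤ Ω(μ)`, the `M_μ[𝔾(𝔸_F^∞)]`-submodule of Def. 4.19 (p. 54) for the fixed `ε` — an `M_μ`-submodule of the
  carrier `Ω(μ)`, PINNED by `Ωε_spec` to the landed defining property `IsOmegaEps` (REAL link). -/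
  Ωε : Submodule (fieldOfValues E D.μ) D.Ω
  /-- `Ω(μ, ε)` has the defining property of Def. 4.19 (landed `Sec42AlbaneseUnitaryShimuraII.IsOmegaEps`). REAL hypothesis. -/
  Ωε_spec : IsOmegaEps D.toThm418Data ε Ωε
  /-- ⟨CARRIER LAW⟩ `Ω(μ, ε)` is `𝔾(𝔸_F^∞)`-stable (Def. 4.19 «`M_μ[𝔾(𝔸_F^∞)]`-submodule»; also the first clause of `IsOmegaEps`,
  repeated as a field so that `g · φ ∈ Ω(μ, ε)` can be written without a lemma). -/
  Ωε_stable : ∀ (g : D.G) (x : D.Ω), x ∈ Ωε → D.rhoΩ g x ∈ Ωε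
  /-- ⟨CARRIER⟩ `Ω(μ^c, −ε) ≤ Ω(μ^c)` (Def. 4.19 for the weight-one conjugate symplectic `μ^c := μ ∘ c` (Rem. 4.4) and the
  `μ^c`-admissible collection `−ε`; Conj. 4.37 p. 66 «`Hom_E(A_K, A_μ^∨, −ε) := Hom_E(A_K, A_μ^∨) ∩ Ω(μ^c, −ε)`»), an `M_μ`-submodule of
  the carrier `Ω(μ^c) = Sec42IIData.Ωc` (no `IsOmegaEps` for `μ^c` exists on that carrier: token). -/
  Ωcε : Submodule (fieldOfValues E D.μ) D.Ωc
  /-- ⟨CARRIER LAW⟩ `Ω(μ^c, −ε)` is `𝔾(𝔸_F^∞)`-stable (Def. 4.19). -/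
  Ωcε_stable : ∀ (g : D.G) (x : D.Ωc), x ∈ Ωcε → D.rhoΩc g x ∈ Ωcε
  /-- ⟨CARRIER⟩ `Hom_E(A_{K'}, A_μ) ⊆ Hom_E(A_{K'}, A_μ)_ℚ`, the lattice of genuine homomorphisms of abelian varieties over `E` inside
  the carrier `HomK K' D_μ = Hom_E(A_{K'}, A_μ)_ℚ` of `Thm418Data` (§4.3 Step 2, p. 60, l. 2427 «Choose an element `φ ∈ Hom_E(A_K, A_μ)`»;
  §4.4 p. 65, l. 2727–2730), for every level `K'`. -/
  HomInt : ∀ K' : Subgroup D.G, AddSubgroup (D.HomK K' Dμ)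
  /-- ⟨CARRIER⟩ `Hom_E(A_{K'}, A_μ^∨) ⊆ Hom_E(A_{K'}, A_μ^∨)_ℚ` likewise (p. 65, l. 2729). -/
  HomIntc : ∀ K' : Subgroup D.G, AddSubgroup (D.HomKc K' Dμ)
  /-- ⟨CARRIER⟩ **the quantity (5.1)** at level `K'` (p. 69, l. 2869–2872): `(φ, φ_c) ↦ vol(K')² · ⟨FJ(f₁, f₂; φ)^z_{K'},
  FJ(f₁^∨, f₂^∨; φ_c)^z_{K'}⟩^{BBP}_{X_{K'} × X_{K'}, A_μ}` for the datum's `f₁, f₂, f₁^∨, f₂^∨, z, D_μ` — `FJ(f₁, f₂; φ)^z_{K'} ∈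
  CH^{n−1+[M_μ:ℚ]/2}(X_{K'} × X_{K'} × A_μ)^0_𝕃` the modified Fourier–Jacobi cycle (§4.4 p. 67, l. 2815–2821: Step 1 of §4.3 with `Δ³X_K`
  replaced by `Δ³_z X_K := pr^{[3]}_{z_K} Δ³X_K`; carpet `Sec44ArithmeticGGP`), `⟨ , ⟩^{BBP}_{X,A}` the Beilinson–Bloch–Poincaré height
  pairing (Def. 3.7, carpet `Sec3CyclesHeightPairings.BBPHeightPairingData.bbp`), `vol(K')` = `Sec42IIData.vol` (Def. 4.22 (2)); «We
  assume that all height pairings are defined» (p. 65, l. 2725).  Defined on `Hom_E(A_{K'}, A_μ)_ℚ × Hom_E(A_{K'}, A_μ^∨)_ℚ`; its values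
  off `Hom_E(A_{K'}, A_μ, ε) × Hom_E(A_{K'}, A_μ^∨, −ε)` are never used. -/
  bbpFJ : ∀ K' : Subgroup D.G, D.HomK K' Dμ → D.HomKc K' Dμ → ℂ
  /-- «an intermediate number field `E ⊆ E' ⊆ ℂ`» (p. 69, l. 2874), REAL as a subfield of `ℂ`. -/
  E' : IntermediateField ℚ ℂ
  /-- «number field» (p. 69): `E'` is finite over `ℚ`. REAL hypothesis. -/
  E'_fd : FiniteDimensional ℚ E'
  /-- «`E ⊆ E'`» (p. 69), `E ⊂ ℂ` through `τ'` (p. 68). REAL hypothesis. -/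
  τ'_range : ∀ x : E, τ' x ∈ E'
  /-- ⟨CARRIER⟩ «`E'` splits `X_{K'}`» (p. 69) — Def. 2.1 (2) (p. 22, l. 1176): «We say that a field `k'` over `k` *splits* `X` if every
  connected component of `X_{k'}` is geometrically connected» (carpet `Sec2AlbaneseVariety`, TL-t08), for a subfield of `ℂ` over `E`
  and the level `K'`. -/
  SplitsX : IntermediateField ℚ ℂ → Subgroup D.G → Prop
  /-- «such that `E'` splits `X_K`» (p. 69, l. 2874). Hypothesis on the carrier predicate. -/
  E'_splits : SplitsX E' K
  /-- ⟨CARRIER⟩ `X_K(π₀(X'_K))` (p. 69, l. 2877), `X'_K := (X_K)_{E'}` — Def. 2.1 (2) (p. 22, l. 1176–1178): «For such `k'`, we regard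
  `π₀(X_{k'})` as a scheme in `Sch_{/k'}` … giving an element in `X(π₀(X_{k'}))` is equivalent to giving an element in `X_i(k')` for
  every connected component `X_i` of `X_{k'}`». -/
  Pts : Type
  /-- ⟨CARRIER⟩ hypothesis of Lem. 5.1 (p. 69, l. 2888): the finite sum «`Σ_i c_i P_i` with `c_i ∈ ℚ` and `P_i ∈ X_K(π₀(X'_K))`»
  REPRESENTS the zero-cycle class `D_K^{n−1}` (`D_K` the Hodge divisor, Def. 4.22 (1), `dim X_K = n − 1`) on `X'_K` (READING R8). -/
  IsRepHodgeTop : List (ℚ × Pts) → Prop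
  /-- ⟨CARRIER⟩ `CH^{2(n−1)}(X'_K × X'_K × X'_K)_ℚ` (codomain of `Δ³_z X_K ∈ CH^{2(n−1)}(X_K × X_K × X_K)^0_ℚ`, p. 67 l. 2817, base-changed
  to `E'` — «We will suppress `E'` in the fiber product», p. 69 l. 2874). Bundled `ModuleCat ℚ`. -/
  CHXXX : ModuleCat.{0} ℚ
  /-- ⟨CARRIER⟩ the class of `Δ³_z X_K := pr^{[3]}_{z_K} Δ³X_K` (p. 67, l. 2815–2817; `pr^{[3]}` of Def. 3.13) in `CHXXX` (base change to
  `E'`), for the datum's `z` and level `K`. -/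
  delta3z : CHXXX
  /-- ⟨CARRIER⟩ `CH^{n−1+[M_μ:ℚ]/2}(X'_K × X'_K × A'_μ)_ℚ`, `A'_μ := (A_μ)_{E'}` (p. 69, l. 2880). -/
  CHXXA : ModuleCat.{0} ℚ
  /-- ⟨CARRIER⟩ `CH^{n−1+[M_μ:ℚ]/2}(X'_K × X'_K × A'^∨_μ)_ℚ` (p. 69, l. 2882). -/
  CHXXAv : ModuleCat.{0} ℚ
  /-- ⟨CARRIER⟩ `(φ, P) ↦ (id_{X'_K × X'_K} × (φ' ∘ α_P))_*`, push-forward `CH(X'_K × X'_K × X'_K) → CH(X'_K × X'_K × A'_μ)` along the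
  morphism built from `φ' := φ_{E'}` (p. 69, l. 2874) and «the induced morphism `α_P := (α_K)_P : X'_K → A'_K` from Definition 2.3 and
  Definition 2.1» (l. 2877–2878; `α_K : ∇X_K → A_K` the Albanese morphism (4.2), `f_x` of Def. 2.1 (3)), for `φ ∈ Hom_E(A_K, A_μ)`
  (values off the lattice `HomInt K` unused) and `P ∈ X_K(π₀(X'_K))`. -/
  pushPhi : D.HomK K Dμ → Pts → (CHXXX →ₗ[ℚ] CHXXA)
  /-- ⟨CARRIER⟩ `(φ_c, P) ↦ (id_{X'_K × X'_K} × (φ'_c ∘ α_P))_*` into `CH(X'_K × X'_K × A'^∨_μ)` likewise (p. 69, l. 2882). -/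
  pushPhic : D.HomKc K Dμ → Pts → (CHXXX →ₗ[ℚ] CHXXAv)
  /-- ⟨CARRIER⟩ `(c₁, c₂) ↦ ⟨(T^{f₁}_K ⊗ T^{f₂}_K ⊗ T^{can}_μ)^* c₁, (T^{f₁^∨}_K ⊗ T^{f₂^∨}_K ⊗ T^{can}_{μ^c})^* c₂⟩^{BBP}_{X'_K × X'_K, A'_μ}`
  (Lem. 5.1, p. 69, l. 2891–2893): the pull-backs along the tensor correspondences of the Hecke correspondences `T^f_K` (§4.3 p. 57,
  l. 2411–2415, «normalized by `vol(K)`») of the datum's four functions and the canonical projectors `T^{can}_μ`, `T^{can}_{μ^c}`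
  (Def. 4.9), followed by the Beilinson–Bloch–Poincaré pairing of `(X'_K × X'_K, A'_μ)` (Def. 3.7) on the (homologically trivial,
  `𝕃 ⊗ M_μ`-linear) results. -/
  bbpPulled : CHXXA → CHXXAv → ℂ
  /-- ⟨CARRIER⟩ `CH¹(A_μ × A^∨_μ)_{M_μ}` (p. 69, l. 2904). Bundled `ModuleCat M_μ`. -/
  CH1AA : ModuleCat.{0} (fieldOfValues E D.μ)
  /-- ⟨CARRIER⟩ the image in `CH¹(A_μ × A^∨_μ)_{M_μ}` of «the Poincaré class `𝒫_μ ∈ CH¹(A_μ × A^∨_μ)` on `A_μ × A^∨_μ`» (p. 69, l. 2901). -/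
  poincare : CH1AA
  /-- ⟨CARRIER⟩ `(T^{can,t}_μ ⊗ T^{can}_{μ^c})^*` on `CH¹(A_μ × A^∨_μ)_{M_μ}` (p. 69, l. 2904; `T^{can,t}_μ` the transpose of the canonical
  projector of Def. 4.9). -/
  pullCan : CH1AA →ₗ[fieldOfValues E D.μ] CH1AA
  /-- ⟨CARRIER⟩ `CH¹(X'_K × X'_K)_{M_μ}` (p. 70, l. 2907). Bundled `ModuleCat M_μ`. -/
  CH1XX' : ModuleCat.{0} (fieldOfValues E D.μ)
  /-- ⟨CARRIER⟩ `(φ, φ_c, P, Q) ↦ (φ' ∘ α_P × φ'_c ∘ α_Q)^* : CH¹(A_μ × A^∨_μ)_{M_μ} → CH¹(X'_K × X'_K)_{M_μ}` (p. 70, l. 2907), for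
  `φ ∈ Hom_E(A_K, A_μ)`, `φ_c ∈ Hom_E(A_K, A_μ^∨)`, `P, Q ∈ X_K(π₀(X'_K))`. -/
  pullPQ : D.HomK K Dμ → D.HomKc K Dμ → Pts → Pts → (CH1AA →ₗ[fieldOfValues E D.μ] CH1XX')
  /-- ⟨CARRIER⟩ `(Q, 𝐟₁, 𝐟₂) ↦ ⟨p_{123}^* Δ³_z X_K, (X'_K × X'_K × Q).p_{124}^* Δ³_{z,𝐟₁,𝐟₂} X_K⟩^{BB}_{X'_K × X'_K × X'_K × X'_K}` (Lem. 5.2,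
  p. 70, l. 2916–2920), «where `Δ³_{z,𝐟₁,𝐟₂} X_K := (T^{𝐟₁}_K ⊗ T^{𝐟₂}_K ⊗ id_{X_K})^* Δ³_z X_K ∈ CH^{2(n−1)}(X_K × X_K × X_K)^0_𝕃` for
  `𝐟₁, 𝐟₂ ∈ ℋ_{K,𝕃}`» (l. 2920), `⟨ , ⟩^{BB}` the Beilinson–Bloch pairing (3.1) of `(X'_K)^4`, `.` the intersection product; for
  `Q ∈ CH¹(X'_K × X'_K)_{M_μ}` and Hecke functions `𝐟₁, 𝐟₂` (values off `ℋ_{K,𝕃}` unused). -/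
  bb4 : CH1XX' → (D.G → L) → (D.G → L) → ℂ
  /-- ⟨CARRIER⟩ `K' ↦ Z¹(X_{K'})_ℂ`, algebraic cycles of codimension `1` on `X_{K'}` with complex coefficients (Def. 5.3, p. 71–72:
  «as an element in `Z¹(X_K)`», «as a formal series in `Z¹(X_K)_ℂ`»). Bundled `ModuleCat ℂ`. -/
  Z1X : Subgroup D.G → ModuleCat.{0} ℂ
  /-- ⟨CARRIER⟩ **the special divisor `Z(x, g)_{K'}`** (Def. 5.3, p. 71, l. 2989–2998), VERBATIM: «Take `x ∈ V(E)^+`, and denote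
  its orthogonal complement in `V` by `V^x`. For `g ∈ G(𝔸^∞)`, we have the composite morphism `s_{x,g} : Sh(G^x, h_{V^x,τ'})_{gKg⁻¹ ∩
  G^x(𝔸^∞)} → Sh(G, h_{V,τ'})_{gKg⁻¹} = X_{gKg⁻¹} →^{T_g} X_K`, where `G^x := Res_{F/ℚ} U(V^x)`, and the first arrow is induced by the
  inclusion `V^x ⊆ V` of hermitian subspaces. The morphism `s_{x,g}` is finite and unramified. We define `Z(x, g)_K :=
  (s_{x,g})_* Sh(G^x, h_{V^x,τ'})_{gKg⁻¹ ∩ G^x(𝔸^∞)}` as an element in `Z¹(X_K)`.»  Regarded in `Z¹(X_{K'})_ℂ`; values at `x ∉ V(E)^+`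
  unused. -/
  specialDivisor : ∀ K' : Subgroup D.G, V.V → D.G → Z1X K'
  /-- ⟨CARRIER⟩ «`D_K` is (some representative of) the Hodge divisor (Definition 4.22)» in `Z¹(X_{K'})_ℂ` (Def. 5.3, p. 72, l. 3004). -/
  hodgeRep : ∀ K' : Subgroup D.G, Z1X K'
  /-- ⟨CARRIER⟩ the INDEX SET of Kudla's double sum at level `K'` (Def. 5.3, p. 72, l. 3001–3003): a set of representatives
  `(x, g)` of the pairs «`x ∈ U(V)(F) \ V(E)^+`», «`g ∈ G^x(𝔸^∞) \ G(𝔸^∞) / K'`» (`G^x(𝔸^∞)` the stabiliser of `x`), read through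
  `idxX`, `idxG`.  (`U(V)(F) = V.rationalPoints` and `G(𝔸^∞)` are REAL; the double-coset enumeration is the token.) -/
  Idx : Subgroup D.G → Type
  /-- ⟨CARRIER⟩ the representative `x ∈ V(E)^+` of an index (Def. 5.3); ⟨CARRIER LAW⟩ totally positive: `idxX_pos`. -/
  idxX : ∀ K' : Subgroup D.G, Idx K' → V.V
  /-- ⟨CARRIER LAW⟩ «`x ∈ V(E)^+`»: `(x, x)_V` is totally positive (Def. 5.3, l. 2989), REAL through `HermSpace.IsPosAt`. -/
  idxX_pos : ∀ (K' : Subgroup D.G) (i : Idx K') (τ : F →+* ℝ), V.IsPosAt τ (idxX K' i)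
  /-- ⟨CARRIER⟩ the representative `g ∈ G(𝔸^∞)` of an index (Def. 5.3). -/
  idxG : ∀ K' : Subgroup D.G, Idx K' → D.G
  /-- ⟨CARRIER⟩ «Chow convergent, that is, an element in `CZ¹(X_{K'})`» (Lem. 5.4, p. 72) — Def. 3.3 (p. 35): «a formal series
  `Σ_j c_j Z_j` with `c_j ∈ ℂ` and `Z_j ∈ Z^i(X)` is *Chow convergent* if the image of `{Z_j}_j` in `CH^i(X)_ℂ` generates a finite
  dimensional subspace, and the induced formal series in this finite dimensional space is absolutely convergent» (typed over its
  own datum as `Sec3CyclesHeightPairings.Sec31Data.IsChowConvergent`), for families of terms `(c_j, Z_j)` in `Z¹(X_{K'})_ℂ` indexed by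
  the leading term (`none`) and `Idx K'`. -/
  IsChowConvergent : ∀ K' : Subgroup D.G, (Option (Idx K') → ℂ × Z1X K') → Prop
  /-- ⟨CARRIER⟩ `K' ↦ CH¹(X_{K'})_ℂ` (Lem. 5.4 proof, p. 72: «`CH¹(X_K)_ℂ` is of finite dimension»). Bundled `ModuleCat ℂ`. -/
  CH1C : Subgroup D.G → ModuleCat.{0} ℂ
  /-- ⟨CARRIER⟩ the «natural complex linear map `CZ^i(X) → CH^i(X)_ℂ`» of Def. 3.3 (p. 35) at `i = 1`, `X = X_{K'}`: the Chow class
  of (the sum of) a Chow convergent family; values off Chow convergent families unused. -/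
  chowSum : ∀ K' : Subgroup D.G, (Option (Idx K') → ℂ × Z1X K') → CH1C K'
  /-- ⟨CARRIER⟩ `K' ↦ H²_B(X_{K'}, ℂ)`, Betti cohomology for `E ⊂ ℂ` via `τ'` (Lem. 5.6 (2)(b), p. 73). Bundled `ModuleCat ℂ`. -/
  H2X : Subgroup D.G → ModuleCat.{0} ℂ
  /-- ⟨CARRIER⟩ `K' ↦ H²_B(X_{K'} × X_{K'}, ℂ)` (Lem. 5.6, p. 73). Bundled `ModuleCat ℂ`. -/
  H2XX : Subgroup D.G → ModuleCat.{0} ℂ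
  /-- ⟨CARRIER⟩ the Betti cycle class map `cl_B : CH¹(X_{K'})_ℂ → H²_B(X_{K'}, ℂ)` (Lem. 5.6 (2)(b): «`cl_B(Z(𝛗)_K) ∈ H²_B(X_K, ℂ)`»). -/
  clB1 : ∀ K' : Subgroup D.G, CH1C K' →ₗ[ℂ] H2X K'
  /-- ⟨CARRIER⟩ `Δ^* : H²_B(X_{K'} × X_{K'}, ℂ) → H²_B(X_{K'}, ℂ)`, pull-back along the diagonal (Lem. 5.6 (2)(b), l. 3054). -/
  diagPull : ∀ K' : Subgroup D.G, H2XX K' →ₗ[ℂ] H2X K'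
  /-- ⟨CARRIER⟩ for `K₁ ⊆ K₂`: the pull-back `H²_B(X_{K₂} × X_{K₂}, ℂ) → H²_B(X_{K₁} × X_{K₁}, ℂ)` along `u^{K₁}_{K₂} × u^{K₁}_{K₂}` (Rem. 5.7,
  p. 73: «compatible under pullbacks»). -/
  pullH2XX : ∀ {K₁ K₂ : Subgroup D.G}, K₁ ≤ K₂ → (H2XX K₂ →ₗ[ℂ] H2XX K₁)
  /-- ⟨CARRIER⟩ `cl_B : CH¹(X'_K × X'_K)_{M_μ} → H²_B(X_K × X_K, ℂ)` (Lem. 5.6 (1), p. 73: «The cohomology class `cl_B(𝒬^{φ,φ_c,P,Q}_{μ,K})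
  ∈ H²_B(X_K × X_K, ℂ)`»; Betti cohomology of `X'_K` and of `X_K` for `E ⊂ E' ⊂ ℂ` is the same space).  Additive (`M_μ ⊂ ℂ`-linear). -/
  clBQ : CH1XX' →+ H2XX K
  /-- ⟨CARRIER⟩ **the map `𝔡` (5.4)** (p. 72, l. 3015–3027; READINGS R2, R5), VERBATIM: «Choose a nonzero element `α` (resp. `α_c`) in
  `H⁰(A_μ(ℂ), Ω¹)` (resp. `H⁰(A_μ^∨(ℂ), Ω¹)`) on which `M_μ` acts via the inclusion `M_μ ↪ ℂ`, such that under the canonical pairing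
  `H¹_B(A_μ, ℂ) × H¹_B(A_μ^∨, ℂ) → ℂ`, `α` and `\bar{α_c}` pair to one. It is clear that for `φ ∈ Ω(μ, ε)` and `φ_c ∈ Ω(μ^c, −ε)`, the
  `(1,1)`-form `φ ◇ φ_c := φ^*α ∧ φ_c^* \bar{α_c}` on `X_K(ℂ)` does not depend on the choice of the pair `(α, α_c)`, which is moreover
  in `H²_B(X_K, M_μ(1))`. By [BMM16, Proposition 5.19] and [Liu14, Lemma 5.3], `φ ◇ φ_c` is a Kudla–Millson form which, in the
  notation of [BMM16, (8.8)], equals `θ_{ψ_F,μ,\tilde𝛗}(−, 1)`, where `\tilde𝛗 = φ_{1,1} ⊗ (⊗_{Φ_F∖{τ}} φ_0) ⊗ 𝛗` for a unique `𝛗 ∈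
  S(V(𝔸_E^∞))` as in [BMM16, (8.9)]. The assignment `(φ, φ_c) ↦ 𝛗` gives rise to a map (5.4) `𝔡 : Ω(μ, ε) ⊗_{M_μ} Ω(μ^c, −ε) ⊗_{M_μ} ℂ
  → S(V(𝔸_E^∞))`.»  Carried as a `ℂ`-linear map into all functions on `V(𝔸_E^∞)`; that its image is `S(V(𝔸_E^∞))` is part of `Lem55`. -/
  dmap : ℂ ⊗[fieldOfValues E D.μ] (Ωε ⊗[fieldOfValues E D.μ] Ωcε) →ₗ[ℂ]
    ((Fin V.n → FiniteAdeleRing (𝓞 E) E) → ℂ)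
  /-- ⟨CARRIER⟩ **`c𝒬_{μ,K'} : S(V(𝔸_E^∞))^{K'} → H²_B(X_{K'} × X_{K'}, ℂ)`, `𝛗 ↦ c𝒬^𝛗_{μ,K'}`**, the unique `ℂ`-linear map of Lem. 5.6 (2)
  (p. 73), at every level `K'` («The maps `{c𝒬_{μ,K}}_K` in Lemma 5.6», Rem. 5.7) — carried on all functions (READING R6); that the
  level-`K` one HAS the printed properties (a), (b) and is unique is `Lem56_2`. -/
  cQ : ∀ K' : Subgroup D.G, ((Fin V.n → FiniteAdeleRing (𝓞 E) E) → ℂ) →ₗ[ℂ] H2XX K'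
  /-- ⟨CARRIER⟩ `K' ↦ Z¹(X_{K'} × X_{K'})_ℂ` (Def. 5.8, p. 74: «an element `Z_K ∈ Z¹(X_K × X_K)_ℂ`»). Bundled `ModuleCat ℂ`. -/
  Z1XX : Subgroup D.G → ModuleCat.{0} ℂ
  /-- ⟨CARRIER⟩ `cl_B : Z¹(X_{K'} × X_{K'})_ℂ → H²_B(X_{K'} × X_{K'}, ℂ)` (Def. 5.8: «`cl_B(Z_K) = c𝒬^𝛗_{μ,K}`»). -/
  clB2 : ∀ K' : Subgroup D.G, Z1XX K' →ₗ[ℂ] H2XX K'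
  /-- ⟨CARRIER⟩ «`Z_K` has proper intersection with `ΔX_K`» (Def. 5.8, p. 74), for `Z ∈ Z¹(X_{K'} × X_{K'})_ℂ`. -/
  MeetsDiagonalProperly : ∀ K' : Subgroup D.G, Z1XX K' → Prop
  /-- ⟨CARRIER⟩ `(f, Z) ↦ ⟨p_{135}^* Δ³_z X_{K'}, (ΔX_{K'} × T^f_{K'} × Z).p_{246}^* Δ³_z X_{K'}⟩^{BB}_{X⁶_{K'}}` (Prop. 5.10, p. 74, l. 3096–3097):
  the Beilinson–Bloch pairing on `X⁶_{K'}` of the two printed cycles built from `Δ³_z X_{K'}`, the diagonal, the Hecke correspondence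
  `T^f_{K'}` of a Hecke function `f ∈ ℋ_{K',𝕃}` and a cycle `Z ∈ Z¹(X_{K'} × X_{K'})_ℂ` — for `Z` a doubling divisor for `𝛗` this is the
  global arithmetic invariant functional `I^z_{K'}(f, 𝛗)` of Def. 5.12 (§5.2 carpet, TL-t13); values off Hecke functions unused. -/
  bb6 : ∀ K' : Subgroup D.G, (D.G → L) → Z1XX K' → ℂ

namespace Sec51Data

variable {D : Sec42IIData F E} (S : Sec51Data D)

/-! ### Plumbing, REAL: `V(𝔸_E^∞)`, the action of `G(𝔸^∞)`, `V(E) ⊂ V(𝔸_E^∞)`, `Hom_E(A_K, A_μ, ε)` -/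

/-- `V(𝔸_E^∞) = V ⊗_E 𝔸_E^∞` in the coordinates of `HermSpace.basis` (READING R5): `(𝔸_E^∞)^n` on Mathlib's finite adèle ring of
`E`, with its product topology. REAL. [cite: Liu2021, Def. 5.3 (p. 72)] -/
abbrev VA : Type := Fin S.V.n → FiniteAdeleRing (𝓞 E) E

/-- The action of `g ∈ 𝔾(𝔸_F^∞) ≃ U(V)(𝔸_F^∞) ≤ GL_n(𝔸_E^∞)` on `V(𝔸_E^∞)`: the matrix of `gIso⁻¹ g` applied to a coordinate vector
(READING R5). REAL over the carrier `gIso`. [cite: Liu2021, Def. 5.3 (p. 72)] -/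
def act (g : D.G) (v : S.VA) : S.VA :=
  Matrix.mulVec (S.gIso.symm g).val.val v

/-- «which admits an action by `G(𝔸^∞)` via the variable» (Def. 5.3, p. 72, l. 3000): `(g𝛗)(v) := 𝛗(g⁻¹ v)` (READING R5). REAL.
[cite: Liu2021, Def. 5.3 (p. 72)] -/
def gFun (g : D.G) (ϕ : S.VA → ℂ) : S.VA → ℂ := fun v => ϕ (S.act g⁻¹ v)

/-- **`S(V(𝔸_E^∞))`** (Def. 5.3, p. 72, l. 3000: «the space of complex valued Schwartz functions on `V(𝔸_E^∞)`»): a function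
`V(𝔸_E^∞) → ℂ` is Schwartz(–Bruhat) iff it is locally constant and compactly supported. REAL (Mathlib `IsLocallyConstant`,
`HasCompactSupport`). [cite: Liu2021, Def. 5.3 (p. 72)] -/
def IsSchwartz (ϕ : S.VA → ℂ) : Prop := IsLocallyConstant ϕ ∧ HasCompactSupport ϕ

/-- **`𝛗 ∈ S(V(𝔸_E^∞))^{K'}`** (Lem. 5.6 (2), p. 73): Schwartz and fixed by every `k ∈ K'`. REAL. [cite: Liu2021, Lem. 5.6 (2) (p. 73)] -/
def IsSchwartzK (K' : Subgroup D.G) (ϕ : S.VA → ℂ) : Prop := S.IsSchwartz ϕ ∧ ∀ k ∈ K', S.gFun k ϕ = ϕ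

/-- `V(E) ⊂ V(𝔸_E^∞)`: the coordinate vector of `x ∈ V` (basis `HermSpace.basis`) pushed along `E → 𝔸_E^∞` (READING R5). REAL.
[cite: Liu2021, Def. 5.3 (p. 72)] -/
def coordA (x : S.V.V) : S.VA := fun i => algebraMap E (FiniteAdeleRing (𝓞 E) E) (S.V.basis.repr x i)

/-- **`V(E)^+`** (Def. 5.3, p. 71, l. 2989), VERBATIM: «Let `V(E)^+ ⊆ V(E)` be the subset consisting of `x` such that `(x, x)_V` is totally
positive.»  REAL: `(x,x)_V` is `τ`-positive for every real embedding `τ` of `F` (`HermSpace.IsPosAt`). [cite: Liu2021, Def. 5.3 (p. 71)] -/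
def Vplus : Set S.V.V := {x | ∀ τ : F →+* ℝ, S.V.IsPosAt τ x}

/-- **`Hom_E(A_{K'}, A_μ, ε) := Hom_E(A_{K'}, A_μ) ∩ Ω(μ, ε)`** (§4.4, p. 65, l. 2727–2728), REAL over the carriers: the lattice
`HomInt K'` intersected with the preimage of `Ω(μ, ε)` under the canonical map `res : Hom_E(A_{K'}, A_μ)_ℚ → Ω(μ)`.
[cite: Liu2021, §4.4 (p. 65)] -/
def HomKε (K' : Subgroup D.G) : AddSubgroup (D.HomK K' S.Dμ) :=
  S.HomInt K' ⊓ S.Ωε.toAddSubgroup.comap (D.res K' S.Dμ)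

/-- **`Hom_E(A_{K'}, A_μ^∨, −ε) := Hom_E(A_{K'}, A_μ^∨) ∩ Ω(μ^c, −ε)`** (§4.4, p. 65, l. 2729–2730), REAL over the carriers likewise
(`resc : Hom_E(A_{K'}, A_μ^∨)_ℚ → Ω(μ^c)`). [cite: Liu2021, §4.4 (p. 65)] -/
def HomKcε (K' : Subgroup D.G) : AddSubgroup (D.HomKc K' S.Dμ) :=
  S.HomIntc K' ⊓ S.Ωcε.toAddSubgroup.comap (D.resc K' S.Dμ)

/-- `[E' : E]` as a rational number (READING R3). REAL. [cite: Liu2021, Lem. 5.1 (p. 69)] -/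
def degE' : ℚ := (Module.finrank ℚ S.E' : ℚ) / (Module.finrank ℚ E : ℚ)

/-! ### Set-up of p. 69 (l. 2879–2884): the cycles `Δ^{φ,P}_z X_K`, `Δ^{φ_c,P}_z X_K` — REAL over the carriers -/

/-- **`Δ^{φ,P}_z X_K := (id_{X'_K × X'_K} × (φ' ∘ α_P))_* Δ³_z X_K ∈ CH^{n−1+[M_μ:ℚ]/2}(X'_K × X'_K × A'_μ)^0_ℚ`** (p. 69, l. 2880–2881).
REAL from the carriers `pushPhi`, `delta3z` (homological triviality «`^0`» is a printed attribute of the value, not typed).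
[cite: Liu2021, §5.1 (p. 69)] -/
def deltaPhi (φ : D.HomK S.K S.Dμ) (P : S.Pts) : S.CHXXA := S.pushPhi φ P S.delta3z

/-- **`Δ^{φ_c,P}_z X_K := (id_{X'_K × X'_K} × (φ'_c ∘ α_P))_* Δ³_z X_K ∈ CH^{n−1+[M_μ:ℚ]/2}(X'_K × X'_K × A'^∨_μ)^0_ℚ`** (p. 69, l. 2882–2883).
REAL from the carriers. [cite: Liu2021, §5.1 (p. 69)] -/
def deltaPhic (φc : D.HomKc S.K S.Dμ) (P : S.Pts) : S.CHXXAv := S.pushPhic φc P S.delta3z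

/-- **[Liu2021, Lemma 5.1] AS PRINTED** (p. 69, l. 2887–2895): «Suppose that `E'` is sufficiently large such that `D_K^{n−1}` can be
represented by a finite sum `Σ_i c_i P_i` with `c_i ∈ ℚ` and `P_i ∈ X_K(π₀(X'_K))`. Then we have (5.1) `= 1 / ([E' : E] (deg D_K^{n−1})²) ·
Σ_{i,j} c_i c_j · ⟨(T^{f₁}_K ⊗ T^{f₂}_K ⊗ T^{can}_μ)^* Δ^{φ,P_i}_z X_K, (T^{f₁^∨}_K ⊗ T^{f₂^∨}_K ⊗ T^{can}_{μ^c})^* Δ^{φ_c,P_j}_z X_K⟩^{BBP}_{X'_K × X'_K,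
A'_μ}`.»  TYPED for the fixed `K, D_μ, f₁, f₂, f₁^∨, f₂^∨, z` of (5.1), every `(φ, φ_c) ∈ Hom_E(A_K, A_μ, ε) × Hom_E(A_K, A_μ^∨, −ε)` (the
standing pair of (5.1)) and every representing list `(c_i, P_i)_i` (READING R8); `deg D_K^{n−1} = Sec42IIData.hodgeDegree K`,
`[E' : E]` by READING R3.  NO PROOF. [cite: Liu2021, Lem. 5.1 (p. 69)] -/
def Lem51 : Prop :=
  ∀ (l : List (ℚ × S.Pts)), S.IsRepHodgeTop l →
    ∀ (φ : D.HomK S.K S.Dμ), φ ∈ S.HomKε S.K → ∀ (φc : D.HomKc S.K S.Dμ), φc ∈ S.HomKcε S.K →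
      S.bbpFJ S.K φ φc =
        ((1 : ℂ) / ((S.degE' : ℂ) * ((D.hodgeDegree S.K : ℂ) ^ 2))) *
          (l.map fun p => (l.map fun q =>
            (p.1 : ℂ) * (q.1 : ℂ) * S.bbpPulled (S.deltaPhi φ p.2) (S.deltaPhic φc q.2)).sum).sum

/-! ### `𝒬_μ` and `𝒬^{φ,φ_c,P,Q}_{μ,K}` (p. 69–70, l. 2901–2908), REAL over the carriers; Lem. 5.2 -/

/-- **`𝒬_μ := (T^{can,t}_μ ⊗ T^{can}_{μ^c})^* 𝒫_μ ∈ CH¹(A_μ × A^∨_μ)_{M_μ}`** (p. 69, l. 2904). REAL from the carriers `pullCan`, `poincare`.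
[cite: Liu2021, §5.1 (p. 69)] -/
def Qμ : S.CH1AA := S.pullCan S.poincare

/-- **`𝒬^{φ,φ_c,P,Q}_{μ,K} := (φ' ∘ α_P × φ'_c ∘ α_Q)^* 𝒬_μ ∈ CH¹(X'_K × X'_K)_{M_μ}`** for `P, Q ∈ X_K(π₀(X'_K))` (p. 70, l. 2905–2908). REAL
from the carrier `pullPQ`. [cite: Liu2021, §5.1 (p. 70)] -/
def QμK (φ : D.HomK S.K S.Dμ) (φc : D.HomKc S.K S.Dμ) (P Q : S.Pts) : S.CH1XX' := S.pullPQ φ φc P Q S.Qμ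

/-- **`𝐟₁ := f₁ᵗ ∗ f₁^∨`** (Prop. 5.10, p. 74, l. 3094; Lem. 5.2 l. 2918), the convolution in `ℋ_{K,𝕃}` of the transpose `f₁ᵗ` with `f₁^∨`.
REAL over the carrier `conv`. [cite: Liu2021, Prop. 5.10 (p. 74)] -/
def bf₁ : D.G → S.L := S.conv S.K (fT S.f₁) S.f₁v

/-- **`𝐟₂ := f₂ᵗ ∗ f₂^∨`** (Prop. 5.10, p. 74, l. 3094). REAL over the carrier `conv`. [cite: Liu2021, Prop. 5.10 (p. 74)] -/
def bf₂ : D.G → S.L := S.conv S.K (fT S.f₂) S.f₂v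

/-- **[Liu2021, Lemma 5.2] AS PRINTED** (p. 70, l. 2912–2922): «For `P, Q ∈ X_K(π₀(X'_K))`, we have `⟨(T^{f₁}_K ⊗ T^{f₂}_K ⊗ T^{can}_μ)^*
Δ^{φ,P}_z X_K, (T^{f₁^∨}_K ⊗ T^{f₂^∨}_K ⊗ T^{can}_{μ^c})^* Δ^{φ_c,Q}_z X_K⟩^{BBP}_{X'_K × X'_K, A'_μ} = ⟨p_{123}^* Δ³_z X_K, (X'_K × X'_K ×
𝒬^{φ,φ_c,P,Q}_{μ,K}).p_{124}^* Δ³_{z, f₁ᵗ∗f₁^∨, f₂ᵗ∗f₂^∨} X_K⟩^{BB}_{X'_K × X'_K × X'_K × X'_K}` where `Δ³_{z,𝐟₁,𝐟₂} X_K := (T^{𝐟₁}_K ⊗ T^{𝐟₂}_K ⊗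
id_{X_K})^* Δ³_z X_K ∈ CH^{2(n−1)}(X_K × X_K × X_K)^0_𝕃` for `𝐟₁, 𝐟₂ ∈ ℋ_{K,𝕃}`.»  TYPED for the standing `(φ, φ_c)` of (5.1) and all `P, Q`:
the left side is the carrier `bbpPulled` on the REAL cycles `Δ^{φ,P}_z`, `Δ^{φ_c,Q}_z`; the right side is the carrier `bb4` on the
REAL class `𝒬^{φ,φ_c,P,Q}_{μ,K}` and the REAL functions `𝐟₁, 𝐟₂`.  NO PROOF. [cite: Liu2021, Lem. 5.2 (p. 70)] -/
def Lem52 : Prop :=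
  ∀ (φ : D.HomK S.K S.Dμ), φ ∈ S.HomKε S.K → ∀ (φc : D.HomKc S.K S.Dμ), φc ∈ S.HomKcε S.K →
    ∀ P Q : S.Pts,
      S.bbpPulled (S.deltaPhi φ P) (S.deltaPhic φc Q) = S.bb4 (S.QμK φ φc P Q) S.bf₁ S.bf₂

/-! ### Def. 5.3 (p. 71–72, l. 2987–3005): Kudla's generating series of special divisors — REAL term by term -/

/-- **The generating series `Z(𝛗)_{K'}`** (Def. 5.3, p. 72, l. 3000–3005), VERBATIM: «For every `𝛗 ∈ S(V(𝔸_E^∞))`, we define *the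
generating series of special divisors* attached to `𝛗` (of level `K`) to be `Z(𝛗)_K := −𝛗(0) D_K + Σ_{x ∈ U(V)(F)\V(E)^+}
e^{−2π·Tr_{F/ℚ}(x,x)_V} Σ_{g ∈ G^x(𝔸^∞)\G(𝔸^∞)/K} 𝛗(g⁻¹x) Z(x, g)_K` as a formal series in `Z¹(X_K)_ℂ`, where `D_K` is (some representative
of) the Hodge divisor (Definition 4.22).»  REAL as the FAMILY OF TERMS `(c_j, Z_j)` of the formal series: the leading term
`(−𝛗(0), D_K)` at `none` and, at an index `i` with representatives `(x, g)`, the term `(e^{−2π Tr_{F/ℚ}(x,x)_V} 𝛗(g⁻¹ x), Z(x, g)_{K'})`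
(READINGS R4, R5; the index set is the carrier `Idx K'`; `Option.elim`: `none` ↦ leading term, `some i` ↦ the `i`-th term). [cite: Liu2021, Def. 5.3 (p. 72)] -/
def genSeries (K' : Subgroup D.G) (ϕ : S.VA → ℂ) (j : Option (S.Idx K')) : ℂ × S.Z1X K' :=
  j.elim (-(ϕ 0), S.hodgeRep K') fun i =>
    ((Real.exp (-(Real.pi * (Algebra.trace ℚ E (S.V.form (S.idxX K' i) (S.idxX K' i)) : ℝ))) : ℂ) *
        ϕ (S.act (S.idxG K' i)⁻¹ (S.coordA (S.idxX K' i))),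
      S.specialDivisor K' (S.idxX K' i) (S.idxG K' i))

/-- **[Liu2021, Lemma 5.4] AS PRINTED** (p. 72, l. 3009–3011): «The generating series of special divisors `Z(𝛗)_K` is Chow convergent,
that is, an element in `CZ¹(X_K)` (Definition 3.3).»  TYPED for every level subgroup `K'` and every Schwartz `𝛗` (Def. 5.3: «For every
`𝛗 ∈ S(V(𝔸_E^∞))`»), over the carrier predicate `IsChowConvergent` (Def. 3.3) applied to the REAL family `genSeries`.  NO PROOF (Liu:
[Liu11a, Thm. 3.5 (2)] with `g = 1`, and `dim CH¹(X_K)_ℂ < ∞`). [cite: Liu2021, Lem. 5.4 (p. 72)] -/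
def Lem54 : Prop :=
  ∀ K' : Subgroup D.G, S.IsLevel K' → ∀ ϕ : S.VA → ℂ, S.IsSchwartz ϕ → S.IsChowConvergent K' (S.genSeries K' ϕ)

/-! ### The map `𝔡` (5.4): Lem. 5.5, Lem. 5.6, Rem. 5.7 -/

/-- The pure tensor `1 ⊗ (φ ⊗ φ_c) ∈ Ω(μ,ε) ⊗_{M_μ} Ω(μ^c,−ε) ⊗_{M_μ} ℂ` (READING R2) of `φ ∈ Ω(μ, ε)`, `φ_c ∈ Ω(μ^c, −ε)` — the argument
«`𝔡(φ ⊗ φ_c)`» of Lem. 5.6 (2)(a), Lem. 5.9, Prop. 5.10. REAL. [cite: Liu2021, §5.1 (5.4) (p. 72)] -/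
def pureT (x : S.Ωε) (y : S.Ωcε) :
    ℂ ⊗[fieldOfValues E D.μ] (S.Ωε ⊗[fieldOfValues E D.μ] S.Ωcε) :=
  (1 : ℂ) ⊗ₜ[fieldOfValues E D.μ] (x ⊗ₜ[fieldOfValues E D.μ] y)

/-- The image in `Ω(μ, ε)` of `φ ∈ Hom_E(A_{K'}, A_μ)_ℚ` with `res φ ∈ Ω(μ, ε)`, as an element of the submodule. REAL plumbing.
[cite: Liu2021, §4.4 (p. 65)] -/
def toΩε (K' : Subgroup D.G) (φ : D.HomK K' S.Dμ) (h : D.res K' S.Dμ φ ∈ S.Ωε) : S.Ωε := ⟨D.res K' S.Dμ φ, h⟩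

/-- The image in `Ω(μ^c, −ε)` of `g · φ_c` for `φ_c ∈ Hom_E(A_{K'}, A_μ^∨)_ℚ` with `resc φ_c ∈ Ω(μ^c, −ε)` and `g ∈ 𝔾(𝔸_F^∞)` (Prop. 5.10:
«`𝔡(φ ⊗ g_s φ_c)`»; `g = 1` gives `φ_c` itself), by the ⟨CARRIER LAW⟩ `Ωcε_stable`. REAL plumbing. [cite: Liu2021, Prop. 5.10 (p. 74)] -/
def toΩcε (K' : Subgroup D.G) (g : D.G) (φc : D.HomKc K' S.Dμ) (h : D.resc K' S.Dμ φc ∈ S.Ωcε) : S.Ωcε :=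
  ⟨D.rhoΩc g (D.resc K' S.Dμ φc), S.Ωcε_stable g _ h⟩

/-- **[Liu2021, Lemma 5.5] AS PRINTED** (p. 72, l. 3030–3032): «The map `𝔡` (5.4) is an isomorphism of `ℂ[G(𝔸^∞)]`-modules.»  TYPED
(READING R1) for the carrier `dmap`: injective, with image exactly the Schwartz functions `S(V(𝔸_E^∞))`, and `G(𝔸^∞)`-equivariant —
`𝔡(c ⊗ (gφ ⊗ gφ_c)) = g · 𝔡(c ⊗ (φ ⊗ φ_c))` for the actions `rhoΩ`, `rhoΩc` (restricted to the stable submodules) and `gFun`.  NO PROOF.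
[cite: Liu2021, Lem. 5.5 (p. 72)] -/
def Lem55 : Prop :=
  Function.Injective S.dmap ∧ Set.range S.dmap = {ϕ | S.IsSchwartz ϕ} ∧
    ∀ (g : D.G) (c : ℂ) (x : S.Ωε) (y : S.Ωcε),
      S.dmap (c ⊗ₜ[fieldOfValues E D.μ]
          ((⟨D.rhoΩ g (x : D.Ω), S.Ωε_stable g _ x.2⟩ : S.Ωε) ⊗ₜ[fieldOfValues E D.μ]
            (⟨D.rhoΩc g (y : D.Ωc), S.Ωcε_stable g _ y.2⟩ : S.Ωcε))) =
        S.gFun g (S.dmap (c ⊗ₜ[fieldOfValues E D.μ] (x ⊗ₜ[fieldOfValues E D.μ] y)))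

/-- **[Liu2021, Lemma 5.6 (1)] AS PRINTED** (p. 73, l. 3043): «The cohomology class `cl_B(𝒬^{φ,φ_c,P,Q}_{μ,K}) ∈ H²_B(X_K × X_K, ℂ)` depends only
on `𝔡(φ ⊗ φ_c)`.»  TYPED: for pairs `(φ, φ_c), (ψ, ψ_c) ∈ Hom_E(A_K, A_μ, ε) × Hom_E(A_K, A_μ^∨, −ε)` and points `P, Q, P₂, Q₂ ∈ X_K(π₀(X'_K))`,
`𝔡(φ ⊗ φ_c) = 𝔡(ψ ⊗ ψ_c)` implies `cl_B(𝒬^{φ,φ_c,P,Q}_{μ,K}) = cl_B(𝒬^{ψ,ψ_c,P₂,Q₂}_{μ,K})` (in particular the class does not depend on `P, Q`).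
NO PROOF. [cite: Liu2021, Lem. 5.6 (1) (p. 73)] -/
def Lem56_1 : Prop :=
  ∀ (φ ψ : D.HomK S.K S.Dμ) (hφi : φ ∈ S.HomInt S.K) (hψi : ψ ∈ S.HomInt S.K)
    (hφ : D.res S.K S.Dμ φ ∈ S.Ωε) (hψ : D.res S.K S.Dμ ψ ∈ S.Ωε)
    (φc ψc : D.HomKc S.K S.Dμ) (hφci : φc ∈ S.HomIntc S.K) (hψci : ψc ∈ S.HomIntc S.K)
    (hφc : D.resc S.K S.Dμ φc ∈ S.Ωcε) (hψc : D.resc S.K S.Dμ ψc ∈ S.Ωcε) (P Q P₂ Q₂ : S.Pts),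
    S.dmap (S.pureT (S.toΩε S.K φ hφ) (S.toΩcε S.K 1 φc hφc)) =
        S.dmap (S.pureT (S.toΩε S.K ψ hψ) (S.toΩcε S.K 1 ψc hψc)) →
      S.clBQ (S.QμK φ φc P Q) = S.clBQ (S.QμK ψ ψc P₂ Q₂)

/-- Property (a) of Lem. 5.6 (2) for a map `c` (p. 73, l. 3050–3051): «`c𝒬^{𝔡(φ⊗φ_c)}_{μ,K} = cl_B(𝒬^{φ,φ_c,P,Q}_{μ,K})` for every pair `(φ, φ_c) ∈
Hom_E(A_K, A_μ, ε) × Hom_E(A_K, A_μ^∨, −ε)` and every `P, Q ∈ X_K(π₀(X'_K))`». REAL predicate on `c`. [cite: Liu2021, Lem. 5.6 (2)(a) (p. 73)] -/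
def PropA (c : (S.VA → ℂ) →ₗ[ℂ] S.H2XX S.K) : Prop :=
  ∀ (φ : D.HomK S.K S.Dμ) (_ : φ ∈ S.HomInt S.K) (hφ : D.res S.K S.Dμ φ ∈ S.Ωε)
    (φc : D.HomKc S.K S.Dμ) (_ : φc ∈ S.HomIntc S.K) (hφc : D.resc S.K S.Dμ φc ∈ S.Ωcε) (P Q : S.Pts),
    c (S.dmap (S.pureT (S.toΩε S.K φ hφ) (S.toΩcε S.K 1 φc hφc))) = S.clBQ (S.QμK φ φc P Q)

/-- Property (b) of Lem. 5.6 (2) for a map `c` (p. 73, l. 3053–3054): «`Δ^* c𝒬^𝛗_{μ,K} = cl_B(Z(𝛗)_K) ∈ H²_B(X_K, ℂ)` for every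
`𝛗 ∈ S(V(𝔸_E^∞))^K`», `cl_B(Z(𝛗)_K)` = the Betti class of the Chow class (carrier `chowSum`, Def. 3.3) of the Chow convergent family
`Z(𝛗)_K` (Lem. 5.4). REAL predicate on `c`, at any level `K'` (every ingredient is level-indexed). [cite: Liu2021, Lem. 5.6 (2)(b) (p. 73)] -/
def PropB (K' : Subgroup D.G) (c : (S.VA → ℂ) →ₗ[ℂ] S.H2XX K') : Prop :=
  ∀ ϕ : S.VA → ℂ, S.IsSchwartzK K' ϕ →
    S.diagPull K' (c ϕ) = S.clB1 K' (S.chowSum K' (S.genSeries K' ϕ))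

/-- **[Liu2021, Lemma 5.6 (2)] AS PRINTED** (p. 73, l. 3045–3055): «There is a unique `ℂ`-linear map `c𝒬_{μ,K} : S(V(𝔸_E^∞))^K →
H²_B(X_K × X_K, ℂ)`, `𝛗 ↦ c𝒬^𝛗_{μ,K}`, such that (a) `c𝒬^{𝔡(φ⊗φ_c)}_{μ,K} = cl_B(𝒬^{φ,φ_c,P,Q}_{μ,K})` for every pair `(φ, φ_c) ∈ Hom_E(A_K, A_μ, ε) ×
Hom_E(A_K, A_μ^∨, −ε)` and every `P, Q ∈ X_K(π₀(X'_K))`; (b) `Δ^* c𝒬^𝛗_{μ,K} = cl_B(Z(𝛗)_K) ∈ H²_B(X_K, ℂ)` for every `𝛗 ∈ S(V(𝔸_E^∞))^K`.»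
TYPED (READING R6) for the carrier `cQ` standing for THE maps `{c𝒬_{μ,K'}}_{K'}` («The maps `{c𝒬_{μ,K}}_K` in Lemma 5.6», Rem. 5.7):
`cQ K` satisfies (a) and (b); `cQ K'` satisfies (b) at every level subgroup `K' ⊆ K` (the lemma at level `K'`; (a) at other levels would
need the points `X_{K'}(π₀(X'_{K'}))`, not carried); and any `ℂ`-linear map satisfying (a) and (b) at level `K` agrees with `cQ K` on
`S(V(𝔸_E^∞))^K`.  NO PROOF. [cite: Liu2021, Lem. 5.6 (2) (p. 73)] -/
def Lem56_2 : Prop :=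
  S.PropA (S.cQ S.K) ∧ (∀ K' : Subgroup D.G, S.IsLevel K' → K' ≤ S.K → S.PropB K' (S.cQ K')) ∧
    ∀ c : (S.VA → ℂ) →ₗ[ℂ] S.H2XX S.K, S.PropA c → S.PropB S.K c →
      ∀ ϕ : S.VA → ℂ, S.IsSchwartzK S.K ϕ → c ϕ = S.cQ S.K ϕ

/-- **[Liu2021, Remark 5.7] AS PRINTED** (p. 73, l. 3067–3070): «The maps `{c𝒬_{μ,K}}_K` in Lemma 5.6 are clearly compatible under
pullbacks, hence induce a `ℂ`-linear map `c𝒬_μ : S(V(𝔸_E^∞)) → H²_B(X_∞ × X_∞, ℂ) := lim_{→ K} H²_B(X_K × X_K, ℂ)`.»  TYPED (the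
compatibility): for level subgroups `K₁ ⊆ K₂` and `𝛗 ∈ S(V(𝔸_E^∞))^{K₂}`, the pull-back of `c𝒬^𝛗_{μ,K₂}` to level `K₁` is `c𝒬^𝛗_{μ,K₁}`.
The induced map to the direct limit is the formal consequence (module docstring, NOT separately typed).  NO PROOF.
[cite: Liu2021, Rem. 5.7 (p. 73)] -/
def Rem57 : Prop :=
  ∀ (K₁ K₂ : Subgroup D.G) (h : K₁ ≤ K₂), S.IsLevel K₁ → S.IsLevel K₂ →
    ∀ ϕ : S.VA → ℂ, S.IsSchwartzK K₂ ϕ → S.pullH2XX h (S.cQ K₂ ϕ) = S.cQ K₁ ϕ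

/-! ### Def. 5.8, Lem. 5.9, Prop. 5.10, Rem. 5.11 -/

/-- **[Liu2021, Definition 5.8] — doubling divisor** (p. 74, l. 3073–3075), VERBATIM: «We say that an element `Z_K ∈ Z¹(X_K × X_K)_ℂ` is
a *doubling divisor (of level `K`)* for an element `𝛗 ∈ S(V(𝔸_E^∞))^K` if `cl_B(Z_K) = c𝒬^𝛗_{μ,K}`, and `Z_K` has proper intersection with
`ΔX_K`.»  REAL over the carriers `clB2`, `cQ`, `MeetsDiagonalProperly`, at any level `K'` (the predicate is written for every
function `𝛗`; it is used for `𝛗 ∈ S(V(𝔸_E^∞))^{K'}`). [cite: Liu2021, Def. 5.8 (p. 74)] -/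
def IsDoublingDivisor (K' : Subgroup D.G) (ϕ : S.VA → ℂ) (Z : S.Z1XX K') : Prop :=
  S.clB2 K' Z = S.cQ K' ϕ ∧ S.MeetsDiagonalProperly K' Z

/-- **[Liu2021, Lemma 5.9] AS PRINTED** (p. 74, l. 3077–3079): «For every element `𝛗 ∈ S(V(𝔸_E^∞))^K`, there exists a doubling divisor
of level `K`.»  TYPED for every level subgroup `K'` (the running `K` of Def. 5.8; Prop. 5.10 invokes it at the levels `K_s`).  NO
PROOF. [cite: Liu2021, Lem. 5.9 (p. 74)] -/
def Lem59 : Prop :=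
  ∀ K' : Subgroup D.G, S.IsLevel K' →
    ∀ ϕ : S.VA → ℂ, S.IsSchwartzK K' ϕ → ∃ Z : S.Z1XX K', S.IsDoublingDivisor K' ϕ Z

/-- **`K_s := K ∩ g_s K g_s⁻¹`** (Prop. 5.10, p. 74, l. 3098). REAL: `gKg⁻¹` is the image of `K` under conjugation by `g`
(`MulAut.conj g`, as in `Sec42IIData.heckePullback`). [cite: Liu2021, Prop. 5.10 (p. 74)] -/
def levelCap (g : D.G) : Subgroup D.G := S.K ⊓ S.K.map (MulAut.conj g).toMonoidHom

/-- **The indicator `𝟙_{g⁻¹K ∩ Kg⁻¹}`** of Prop. 5.10 (p. 74, l. 3094), REAL: the characteristic function of the subset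
`g⁻¹K ∩ Kg⁻¹ ⊆ 𝔾(𝔸_F^∞)` (left and right translates of `K`), `𝕃`-valued (cf. the §4.3 carpet's `indicatorFun K = 𝟙_K`).
[cite: Liu2021, Prop. 5.10 (p. 74)] -/
def indKK (g : D.G) : D.G → S.L :=
  Set.indicator ((g⁻¹ • (S.K : Set D.G)) ∩ (MulOpposite.op g⁻¹ • (S.K : Set D.G))) (fun _ => (1 : S.L))

/-- **[Liu2021, Proposition 5.10] — the doubling formula for CM data, AS PRINTED** (p. 74, l. 3093–3100): «Put `𝐟_i := f_iᵗ ∗ f_i^∨` for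
`i = 1, 2`. If we write `𝐟₁ = Σ_s d_s 𝟙_{g_s⁻¹K ∩ Kg_s⁻¹}` as a finite sum with `d_s ∈ 𝕃` and `g_s ∈ U(V)(𝔸_F^∞)`,[footnote 10: It is elementary to
see that every element in `ℋ_{K,𝕃}` can be written in this way.] then (5.1) `= Σ_s d_s · ⟨p_{135}^* Δ³_z X_{K_s}, (ΔX_{K_s} × T^{L_{g_s}𝐟₂}_{K_s} ×
Z^s_{K_s}).p_{246}^* Δ³_z X_{K_s}⟩^{BB}_{X⁶_{K_s}}` holds, where `K_s := K ∩ g_s K g_s⁻¹`, and `Z^s_{K_s} ∈ Z¹(X_K × X_K)_ℂ` is an arbitrary doubling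
divisor for `𝔡(φ ⊗ g_s φ_c)` (which exists by Lemma 5.9).»  TYPED for the standing `(φ, φ_c) ∈ Hom_E(A_K, A_μ, ε) × Hom_E(A_K, A_μ^∨, −ε)` of
(5.1), every finite family `(d_s, g_s)_s` (READING R8; `U(V)(𝔸_F^∞) = G(𝔸^∞)` under `gIso`) with `𝐟₁ = Σ_s d_s 𝟙_{g_s⁻¹K ∩ Kg_s⁻¹}` as
functions, and EVERY choice of doubling divisors `Z^s` of level `K_s` for `𝔡(φ ⊗ g_s φ_c)` («arbitrary»; READING R7): (5.1) equals
the printed sum, the summand being the carrier `bb6` at level `K_s` on the REAL function `L_{g_s} 𝐟₂` (`leftTranslate`, §4.3 carpet) and `Z^s`.  NO PROOF.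
[cite: Liu2021, Prop. 5.10 (p. 74)] -/
def Prop510 : Prop :=
  ∀ (φ : D.HomK S.K S.Dμ) (_ : φ ∈ S.HomInt S.K) (hφ : D.res S.K S.Dμ φ ∈ S.Ωε)
    (φc : D.HomKc S.K S.Dμ) (_ : φc ∈ S.HomIntc S.K) (hφc : D.resc S.K S.Dμ φc ∈ S.Ωcε)
    (m : ℕ) (d : Fin m → S.L) (g : Fin m → D.G),
    (S.bf₁ = fun x => ∑ s : Fin m, d s * S.indKK (g s) x) →
      ∀ Z : ∀ s : Fin m, S.Z1XX (S.levelCap (g s)),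
        (∀ s : Fin m, S.IsDoublingDivisor (S.levelCap (g s))
            (S.dmap (S.pureT (S.toΩε S.K φ hφ) (S.toΩcε S.K (g s) φc hφc))) (Z s)) →
          S.bbpFJ S.K φ φc =
            ∑ s : Fin m, (d s : ℂ) * S.bb6 (S.levelCap (g s)) (Sec43FourierJacobiCycles.leftTranslate (g s) S.bf₂) (Z s)

/-- **[Liu2021, Remark 5.11] AS PRINTED** (p. 76, l. 3139–3150): «Proposition 5.10 implies that, for given data `f₁, f₂, f₁^∨, f₂^∨, z`, the
assignment `Hom_E(A_K, A_μ, ε) × Hom_E(A_K, A_μ^∨, −ε) → ℂ`, `(φ, φ_c) ↦ vol(K)² · ⟨FJ(f₁, f₂; φ)^z_K, FJ(f₁^∨, f₂^∨; φ_c)^z_K⟩^{BBP}_{X_K × X_K, A_μ}` factors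
through `Ω(μ, ε) ⊗_{M_μ} Ω(μ^c, −ε)` and extends uniquely to an `M_μ`-linear map `Ω(μ, ε) ⊗_{M_μ} Ω(μ^c, −ε) → ℂ` by considering all level
subgroups `K`.»  TYPED: there is exactly one `M_μ`-linear `B : Ω(μ,ε) ⊗_{M_μ} Ω(μ^c,−ε) → ℂ` such that for every level subgroup `K'` and every
`(φ, φ_c) ∈ Hom_E(A_{K'}, A_μ, ε) × Hom_E(A_{K'}, A_μ^∨, −ε)`, (5.1) at level `K'` equals `B(φ ⊗ φ_c)` (images in `Ω(μ,ε)`, `Ω(μ^c,−ε)` under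
`res`, `resc`); the levels range over the level subgroups `K' ⊆ K` — those at which the given `f₁, f₂, f₁^∨, f₂^∨ ∈ ℋ_{K,𝕃} ⊆
ℋ_{K',𝕃}` ARE data and (5.1) is a printed quantity (QA reading of «by considering all level subgroups `K`»).  NO PROOF.
[cite: Liu2021, Rem. 5.11 (p. 76)] -/
def Rem511 : Prop :=
  ∃! B : (S.Ωε ⊗[fieldOfValues E D.μ] S.Ωcε) →ₗ[fieldOfValues E D.μ] ℂ,
    ∀ K' : Subgroup D.G, S.IsLevel K' → K' ≤ S.K →
      ∀ (φ : D.HomK K' S.Dμ) (_ : φ ∈ S.HomInt K') (hφ : D.res K' S.Dμ φ ∈ S.Ωε)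
        (φc : D.HomKc K' S.Dμ) (_ : φc ∈ S.HomIntc K') (hφc : D.resc K' S.Dμ φc ∈ S.Ωcε),
        S.bbpFJ K' φ φc = B (S.toΩε K' φ hφ ⊗ₜ[fieldOfValues E D.μ] S.toΩcε K' 1 φc hφc)

end Sec51Data

end Literature.NumberTheory.Automorphic.Liu2021.Sec51DoublingFormulaCMData

end
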